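import Summits.HodgeConjecture.HodgeConjecture.Theorems.BiquadraticSecantLiftTwelvefoldWeilType
import Literature.AlgebraicGeometry.Deligne1982.ProductPolarizationDiscriminantCM
import Literature.AlgebraicGeometry.Motives.RationalDegreeOneModelWeilType
import Literature.AlgebraicGeometry.HodgeTheory.WeilTypePeriodPoint
import HarnessLib

/-!
# BiquadraticSecantLift · X2 — the polarization pairing of `h₂ = π₀^* k + m·π₁^* k` on `H¹(⨁_{Fin 2} A)`:
# blocks, and the Rosati condition for `η = (φ ⊕ φ) ≫ (𝟙 + ψ_m)`

Helper file for crux X2 `BiquadraticBaseChangeHyperbolic` (stmt-HodgeConjecture-22133) of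
route-HodgeConjecture-BiquadraticSecantLift. `B = ⨁_{Fin 2} A`, `h₂ = Milne1999.sumPolarizationClass (fun _ => A) ![k, m·k]
= π₀^* k + m·π₁^* k` («`E_A ⊕ m·E_A`» read on `H¹`, where the Riemann form dualises to `m·Q ⊕ Q`), `Q = Q_k =
k^{dim A - 1} ⌣ (· ⌣ ·)` on `H¹(A)`, `Q₂ = Q_{h₂}` on `H¹(B)`.

* §1 `K`-compatibility on `A`: `φ^* k = d·k` ⟹ `Q(φ^*x, φ^*y) = d·Q(x, y)` ⟹ `Q(φ^*x, y) = -Q(x, φ^*y)` (the tree's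
  `polarizationPairingOne_map_map_ksymm` for an arbitrary class with `φ^* k = d·k`).
* §2 blocks: `Q₂(πᵢ^* x, πⱼ^* y) = 0` (`i ≠ j`, Milne); if `Q(x, y) = c·L(k)` (`L(k) = k^{dim A}`) then
  `Q₂(π₀^*x, π₀^*y) = (c/2)·L(h₂)` and `Q₂(π₁^*x, π₁^*y) = (c/(2m))·L(h₂)`.
* §3 **Rosati for `η`**: `Q₂(η^*u, v) = -Q₂(u, η^*v)` from `Q(φ^*x, y) = -Q(x, φ^*y)` on `A` — the polarization
  `E_A ⊕ m E_A` makes the Rosati involution complex conjugation on `L = ℚ(η)` (`ψ_m` is Rosati-SYMMETRIC for it).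

Nothing here is a case of the Hodge conjecture (HC is NOT proved; X2 is not proved by this file).

## References
[cite: Deligne1982HodgeCycles, §4 p. 33 and §5 (c) p. 39] [cite: Milne1999LefschetzClasses, §1 p. 643]
[cite: LangeBirkenhake1992, §5.2–5.3] [cite: vanGeemen1994HodgeAV, Lemma 5.2 (2)]
-/

-- every declaration of this problem lives in `Summit.HodgeConjecture.HodgeConjecture.…` (summit = sub-problem)
set_option linter.dupNamespace false

noncomputable section

open CategoryTheory CategoryTheory.Limits Polynomial Module
open Literature.AlgebraicTopology.SingularHomology Literature.Geometry.Kaehler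
open Literature.AlgebraicGeometry.HodgeTheory
open Literature.AlgebraicGeometry.Motives (AbelianVariety IsSmoothProjective polarizationPairingOne
  polarizationPairingOne_smul map_polarizationPairingOne)
open Literature.AlgebraicGeometry.Milne1999 (sumPolarizationClass sumPolarizationClass_def
  polarizationPairingOne_sum_map_π_map_π_of_ne dim_biproduct_pos)
open Literature.AlgebraicGeometry.Deligne1982 (polarizationPairingOne_sum_map_π_map_π_eq_smul)
open Literature.AlgebraicGeometry.Pohlmann1968 (sum_map_π_map_ι)

namespace Summit.HodgeConjecture.HodgeConjecture.BiquadraticSecantLift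

variable {A : AbelianVariety ℂ} {φ : A ⟶ A} {d m : ℕ} {k : complexBetti A.X 2}

/-! ## §1 `K`-compatibility of a class with `φ^* k = d·k` -/

section KCompatible

/-- **`Q_k(φ^*x, φ^*y) = d · Q_k(x, y)`** for `φ ≫ φ = -d` (`d ≥ 1`) and a class with `φ^* k = d·k` (naturality of `Q`,
`Q_{d k} = d^j Q_k`, and `φ^* = d^{dim A}` on the top cohomology, `Motives.map_top_eq_pow_smul`). -/
theorem polarizationPairingOne_map_map_of_map_eq_smul {j : ℕ} (hA : A.dim = j + 1) (hd : 0 < d)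
    (hφ : φ ≫ φ = -(d • 𝟙 A)) (hk : complexBetti.map φ.hom.hom.hom 2 k = (d : ℂ) • k) (x y : complexBetti A.X 1) :
    polarizationPairingOne A.X k j (complexBetti.map φ.hom.hom.hom 1 x) (complexBetti.map φ.hom.hom.hom 1 y) =
      (d : ℂ) • polarizationPairingOne A.X k j x y := by
  have hrank := Literature.AlgebraicGeometry.Motives.abelianVarietyCohomologyExteriorH1.finrank_one
    Literature.AlgebraicGeometry.Motives.abelianVarietyCohomologyExteriorH1_holds A
  have hspan := Literature.AlgebraicGeometry.Motives.abelianVarietyCohomologyExteriorH1.span_range_cupPowOne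
    Literature.AlgebraicGeometry.Motives.abelianVarietyCohomologyExteriorH1_holds A (2 + 2 * j)
  have e2 := map_polarizationPairingOne φ.hom.hom.hom k j x y
  rw [hk, polarizationPairingOne_smul, Literature.AlgebraicGeometry.Motives.map_top_eq_pow_smul hA hrank hspan hd hφ,
    pow_succ, mul_smul] at e2
  have hd0 : ((d : ℂ) ^ j) ≠ 0 := pow_ne_zero _ (Nat.cast_ne_zero.2 hd.ne')
  exact (smul_right_injective _ hd0 e2).symm

/-- **`Q_k(φ^*x, y) = -Q_k(x, φ^*y)`**: the Rosati involution of a `K`-compatible class is complex conjugation on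
`K = ℚ(φ)`. -/
theorem polarizationPairingOne_map_left_of_map_eq_smul {j : ℕ} (hA : A.dim = j + 1) (hd : 0 < d)
    (hφ : φ ≫ φ = -(d • 𝟙 A)) (hk : complexBetti.map φ.hom.hom.hom 2 k = (d : ℂ) • k) (x y : complexBetti A.X 1) :
    polarizationPairingOne A.X k j (complexBetti.map φ.hom.hom.hom 1 x) y =
      -polarizationPairingOne A.X k j x (complexBetti.map φ.hom.hom.hom 1 y) := by
  have hd0 : (d : ℂ) ≠ 0 := Nat.cast_ne_zero.2 hd.ne'
  have h1 := polarizationPairingOne_map_map_of_map_eq_smul hA hd hφ hk x (complexBetti.map φ.hom.hom.hom 1 y)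
  rw [complexBetti_map_map_one_of_comp_self hφ y, map_neg, map_smul] at h1
  have h3 : (d : ℂ) • polarizationPairingOne A.X k j (complexBetti.map φ.hom.hom.hom 1 x) y =
      (d : ℂ) • -polarizationPairingOne A.X k j x (complexBetti.map φ.hom.hom.hom 1 y) := by
    rw [smul_neg, ← h1, neg_neg]
  exact smul_right_injective _ hd0 h3

/-- `φ^*(d·κ + φ^*κ) = d·(d·κ + φ^*κ)` (the tree's `map_ksymm_eq_smul`). -/
theorem map_ksymm_eq_smul' (hφ : φ ≫ φ = -(d • 𝟙 A)) (κ : complexBetti A.X 2) :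
    complexBetti.map φ.hom.hom.hom 2 ((d : ℂ) • κ + complexBetti.map φ.hom.hom.hom 2 κ) =
      (d : ℂ) • ((d : ℂ) • κ + complexBetti.map φ.hom.hom.hom 2 κ) :=
  map_ksymm_eq_smul hφ κ

end KCompatible

/-! ## §2 The blocks of `Q_{h₂}` on `H¹(⨁_{Fin 2} A)` -/

section Blocks

variable (A k m)

/-- `h₂ = Σⱼ πⱼ^* (![k, m·k] j) = π₀^* k + m·π₁^* k`. -/
theorem sumPolarizationClass_two_eq :
    sumPolarizationClass (fun _ : Fin 2 => A) ![k, (m : ℂ) • k] =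
      complexBetti.map (biproduct.π (fun _ : Fin 2 => A) 0).hom.hom.hom 2 k +
        (m : ℂ) • complexBetti.map (biproduct.π (fun _ : Fin 2 => A) 1).hom.hom.hom 2 k := by
  rw [sumPolarizationClass_def, Fin.sum_univ_two, Matrix.cons_val_zero, Matrix.cons_val_one, Matrix.cons_val_zero,
    map_smul]

variable {A k m}

/-- The top line of `A` is spanned by `L(k) = k^{dim A}` once `L(k) ≠ 0`: `Q_k(x, y) = c·L(k)` for some `c`. -/
theorem exists_polarizationPairingOne_eq_smul (hA : 0 < A.dim) (hLk : lefschetzPow k (A.dim - 1) 2 k ≠ 0)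
    (x y : complexBetti A.X 1) : ∃ c : ℂ, polarizationPairingOne A.X k (A.dim - 1) x y = c • lefschetzPow k (A.dim - 1) 2 k := by
  have hA' : A.dim = A.dim - 1 + 1 := by omega
  have h1 := Literature.AlgebraicGeometry.Motives.finrank_complexBetti_two_add_two_mul_eq_one
    (Literature.AlgebraicGeometry.Motives.isSmoothProjective_of_dim_eq' hA')
  obtain ⟨c, hc⟩ := (finrank_eq_one_iff_of_nonzero' _ hLk).1 h1 (polarizationPairingOne A.X k (A.dim - 1) x y)
  exact ⟨c, hc.symm⟩

/-- `L(m·k) = m^{dim A} · L(k)`. -/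
theorem lefschetzPow_smul_self (hA : 0 < A.dim) (c : ℂ) :
    lefschetzPow (c • k) (A.dim - 1) 2 (c • k) = c ^ A.dim • lefschetzPow k (A.dim - 1) 2 k := by
  rw [Literature.AlgebraicGeometry.Motives.lefschetzPow_smul, map_smul, smul_smul, ← pow_succ,
    Nat.sub_add_cancel (Nat.one_le_iff_ne_zero.2 hA.ne')]

/-- The mixed blocks vanish: `Q₂(π₀^* x, π₁^* y) = 0` and `Q₂(π₁^* x, π₀^* y) = 0`. -/
theorem pairing_two_cross (hA : 0 < A.dim) {i j : Fin 2} (hij : i ≠ j) (x y : complexBetti A.X 1) :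
    polarizationPairingOne (twelvefold A).X (sumPolarizationClass (fun _ : Fin 2 => A) ![k, (m : ℂ) • k])
        ((twelvefold A).dim - 1) (complexBetti.map (biproduct.π (fun _ : Fin 2 => A) i).hom.hom.hom 1 x)
        (complexBetti.map (biproduct.π (fun _ : Fin 2 => A) j).hom.hom.hom 1 y) = 0 :=
  polarizationPairingOne_sum_map_π_map_π_of_ne (fun _ : Fin 2 => A) _ (fun _ => hA) hij x y

/-- **The `(0,0)` block**: `Q_k(x, y) = c·L(k)` ⟹ `Q₂(π₀^* x, π₀^* y) = (c/2)·L(h₂)`. -/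
theorem pairing_two_block_zero (hA : 0 < A.dim) {x y : complexBetti A.X 1} {c : ℂ}
    (hc : polarizationPairingOne A.X k (A.dim - 1) x y = c • lefschetzPow k (A.dim - 1) 2 k) :
    polarizationPairingOne (twelvefold A).X (sumPolarizationClass (fun _ : Fin 2 => A) ![k, (m : ℂ) • k])
        ((twelvefold A).dim - 1) (complexBetti.map (biproduct.π (fun _ : Fin 2 => A) 0).hom.hom.hom 1 x)
        (complexBetti.map (biproduct.π (fun _ : Fin 2 => A) 0).hom.hom.hom 1 y) =
      (c / 2) • lefschetzPow (sumPolarizationClass (fun _ : Fin 2 => A) ![k, (m : ℂ) • k]) ((twelvefold A).dim - 1) 2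
        (sumPolarizationClass (fun _ : Fin 2 => A) ![k, (m : ℂ) • k]) := by
  have h := polarizationPairingOne_sum_map_π_map_π_eq_smul (fun _ : Fin 2 => A) ![k, (m : ℂ) • k] (fun _ => hA) 0 x y c
    (by rw [Matrix.cons_val_zero]; exact hc)
  rw [h]
  congr 1
  change ((A.dim : ℂ) / ((⨁ (fun _ : Fin 2 => A)).dim : ℂ)) * c = c / 2
  rw [dim_twelvefold]
  have hA0 : (A.dim : ℂ) ≠ 0 := Nat.cast_ne_zero.2 hA.ne'
  push_cast
  field_simp
  ring

/-- **The `(1,1)` block** (slot class `m·k`, `m ≠ 0`): `Q_k(x, y) = c·L(k)` ⟹ `Q₂(π₁^* x, π₁^* y) = (c/(2m))·L(h₂)`. -/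
theorem pairing_two_block_one (hA : 0 < A.dim) (hm : (m : ℂ) ≠ 0) {x y : complexBetti A.X 1} {c : ℂ}
    (hc : polarizationPairingOne A.X k (A.dim - 1) x y = c • lefschetzPow k (A.dim - 1) 2 k) :
    polarizationPairingOne (twelvefold A).X (sumPolarizationClass (fun _ : Fin 2 => A) ![k, (m : ℂ) • k])
        ((twelvefold A).dim - 1) (complexBetti.map (biproduct.π (fun _ : Fin 2 => A) 1).hom.hom.hom 1 x)
        (complexBetti.map (biproduct.π (fun _ : Fin 2 => A) 1).hom.hom.hom 1 y) =
      (c / (2 * (m : ℂ))) • lefschetzPow (sumPolarizationClass (fun _ : Fin 2 => A) ![k, (m : ℂ) • k])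
        ((twelvefold A).dim - 1) 2 (sumPolarizationClass (fun _ : Fin 2 => A) ![k, (m : ℂ) • k]) := by
  -- `Q_{m k}(x, y) = (c/m) · L(m k)`
  have hc' : polarizationPairingOne A.X ((m : ℂ) • k) (A.dim - 1) x y =
      (c / (m : ℂ)) • lefschetzPow ((m : ℂ) • k) (A.dim - 1) 2 ((m : ℂ) • k) := by
    rw [polarizationPairingOne_smul, hc, lefschetzPow_smul_self hA, smul_smul, smul_smul]
    congr 1
    rw [← Nat.sub_add_cancel (Nat.one_le_iff_ne_zero.2 hA.ne'), pow_succ, Nat.add_sub_cancel]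
    field_simp
  have h := polarizationPairingOne_sum_map_π_map_π_eq_smul (fun _ : Fin 2 => A) ![k, (m : ℂ) • k] (fun _ => hA) 1 x y
    (c / (m : ℂ)) (by rw [Matrix.cons_val_one, Matrix.cons_val_zero]; exact hc')
  rw [h]
  congr 1
  change ((A.dim : ℂ) / ((⨁ (fun _ : Fin 2 => A)).dim : ℂ)) * (c / (m : ℂ)) = c / (2 * (m : ℂ))
  rw [dim_twelvefold]
  have hA0 : (A.dim : ℂ) ≠ 0 := Nat.cast_ne_zero.2 hA.ne'
  push_cast
  field_simp
  ring

end Blocks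

/-! ## §3 The Rosati condition for `η = (φ ⊕ φ) ≫ (𝟙 + ψ_m)` -/

section Rosati

variable (A m)

/-- `η^* (π₀^* y) = π₀^* (φ^* y) + m · π₁^* (φ^* y)`. -/
theorem map_etaTwo_map_π_zero (φ : A ⟶ A) (y : complexBetti A.X 1) :
    complexBetti.map (etaTwo A φ m).hom.hom.hom 1 (complexBetti.map (biproduct.π (fun _ : Fin 2 => A) 0).hom.hom.hom 1 y) =
      complexBetti.map (biproduct.π (fun _ : Fin 2 => A) 0).hom.hom.hom 1 (complexBetti.map φ.hom.hom.hom 1 y) +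
        (m : ℂ) • complexBetti.map (biproduct.π (fun _ : Fin 2 => A) 1).hom.hom.hom 1 (complexBetti.map φ.hom.hom.hom 1 y) := by
  rw [map_etaTwo, map_psiTwo_map_π_zero, map_add, map_smul, map_phiTwo_map_π, map_phiTwo_map_π]

/-- `η^* (π₁^* y) = π₁^* (φ^* y) + π₀^* (φ^* y)`. -/
theorem map_etaTwo_map_π_one (φ : A ⟶ A) (y : complexBetti A.X 1) :
    complexBetti.map (etaTwo A φ m).hom.hom.hom 1 (complexBetti.map (biproduct.π (fun _ : Fin 2 => A) 1).hom.hom.hom 1 y) =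
      complexBetti.map (biproduct.π (fun _ : Fin 2 => A) 1).hom.hom.hom 1 (complexBetti.map φ.hom.hom.hom 1 y) +
        complexBetti.map (biproduct.π (fun _ : Fin 2 => A) 0).hom.hom.hom 1 (complexBetti.map φ.hom.hom.hom 1 y) := by
  rw [map_etaTwo, map_psiTwo_map_π_one, map_add, map_phiTwo_map_π, map_phiTwo_map_π]

variable {A m}

/-- The `(1,1)` block is `m⁻¹` times the `(0,0)` block: `m · Q₂(π₁^* x, π₁^* y) = Q₂(π₀^* x, π₀^* y)`. -/
theorem pairing_two_block_one_eq (hA : 0 < A.dim) (hm : (m : ℂ) ≠ 0) (hLk : lefschetzPow k (A.dim - 1) 2 k ≠ 0)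
    (x y : complexBetti A.X 1) :
    (m : ℂ) • polarizationPairingOne (twelvefold A).X (sumPolarizationClass (fun _ : Fin 2 => A) ![k, (m : ℂ) • k])
        ((twelvefold A).dim - 1) (complexBetti.map (biproduct.π (fun _ : Fin 2 => A) 1).hom.hom.hom 1 x)
        (complexBetti.map (biproduct.π (fun _ : Fin 2 => A) 1).hom.hom.hom 1 y) =
      polarizationPairingOne (twelvefold A).X (sumPolarizationClass (fun _ : Fin 2 => A) ![k, (m : ℂ) • k])
        ((twelvefold A).dim - 1) (complexBetti.map (biproduct.π (fun _ : Fin 2 => A) 0).hom.hom.hom 1 x)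
        (complexBetti.map (biproduct.π (fun _ : Fin 2 => A) 0).hom.hom.hom 1 y) := by
  obtain ⟨c, hc⟩ := exists_polarizationPairingOne_eq_smul hA hLk x y
  rw [pairing_two_block_one hA hm hc, pairing_two_block_zero hA hc, smul_smul]
  congr 1
  field_simp

/-- The `(0,0)` block is Rosati-skew for `φ`: `Q₂(π₀^* φ^* x, π₀^* y) = -Q₂(π₀^* x, π₀^* φ^* y)` (from `A`). -/
theorem pairing_two_block_zero_rosati (hA : 0 < A.dim) (hLk : lefschetzPow k (A.dim - 1) 2 k ≠ 0)
    (hros : ∀ x y : complexBetti A.X 1,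
      polarizationPairingOne A.X k (A.dim - 1) (complexBetti.map φ.hom.hom.hom 1 x) y =
        -polarizationPairingOne A.X k (A.dim - 1) x (complexBetti.map φ.hom.hom.hom 1 y))
    (x y : complexBetti A.X 1) :
    polarizationPairingOne (twelvefold A).X (sumPolarizationClass (fun _ : Fin 2 => A) ![k, (m : ℂ) • k])
        ((twelvefold A).dim - 1)
        (complexBetti.map (biproduct.π (fun _ : Fin 2 => A) 0).hom.hom.hom 1 (complexBetti.map φ.hom.hom.hom 1 x))
        (complexBetti.map (biproduct.π (fun _ : Fin 2 => A) 0).hom.hom.hom 1 y) =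
      -polarizationPairingOne (twelvefold A).X (sumPolarizationClass (fun _ : Fin 2 => A) ![k, (m : ℂ) • k])
        ((twelvefold A).dim - 1) (complexBetti.map (biproduct.π (fun _ : Fin 2 => A) 0).hom.hom.hom 1 x)
        (complexBetti.map (biproduct.π (fun _ : Fin 2 => A) 0).hom.hom.hom 1 (complexBetti.map φ.hom.hom.hom 1 y)) := by
  obtain ⟨c, hc⟩ := exists_polarizationPairingOne_eq_smul hA hLk x (complexBetti.map φ.hom.hom.hom 1 y)
  have hc' : polarizationPairingOne A.X k (A.dim - 1) (complexBetti.map φ.hom.hom.hom 1 x) y =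
      (-c) • lefschetzPow k (A.dim - 1) 2 k := by rw [hros, hc, neg_smul]
  rw [pairing_two_block_zero hA hc, pairing_two_block_zero hA hc', ← neg_smul]
  congr 1
  ring

/-- **The Rosati involution of `h₂ = π₀^* k + m·π₁^* k` is complex conjugation on `L = ℚ(η)`**:
`Q₂(η^* u, v) = -Q₂(u, η^* v)` on `H¹(⨁_{Fin 2} A)`, given the same for `(k, φ)` on `A` (`m ≠ 0`, `L(k) ≠ 0`). -/
theorem rosati_etaTwo (hA : 0 < A.dim) (hm : (m : ℂ) ≠ 0) (hLk : lefschetzPow k (A.dim - 1) 2 k ≠ 0)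
    (hros : ∀ x y : complexBetti A.X 1,
      polarizationPairingOne A.X k (A.dim - 1) (complexBetti.map φ.hom.hom.hom 1 x) y =
        -polarizationPairingOne A.X k (A.dim - 1) x (complexBetti.map φ.hom.hom.hom 1 y))
    (u v : complexBetti (twelvefold A).X 1) :
    polarizationPairingOne (twelvefold A).X (sumPolarizationClass (fun _ : Fin 2 => A) ![k, (m : ℂ) • k])
        ((twelvefold A).dim - 1) (complexBetti.map (etaTwo A φ m).hom.hom.hom 1 u) v =
      -polarizationPairingOne (twelvefold A).X (sumPolarizationClass (fun _ : Fin 2 => A) ![k, (m : ℂ) • k])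
        ((twelvefold A).dim - 1) u (complexBetti.map (etaTwo A φ m).hom.hom.hom 1 v) := by
  set Q₂ := polarizationPairingOne (twelvefold A).X (sumPolarizationClass (fun _ : Fin 2 => A) ![k, (m : ℂ) • k])
    ((twelvefold A).dim - 1) with hQ₂
  set a₀ := complexBetti.map (biproduct.ι (fun _ : Fin 2 => A) 0).hom.hom.hom 1 u
  set a₁ := complexBetti.map (biproduct.ι (fun _ : Fin 2 => A) 1).hom.hom.hom 1 u
  set b₀ := complexBetti.map (biproduct.ι (fun _ : Fin 2 => A) 0).hom.hom.hom 1 v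
  set b₁ := complexBetti.map (biproduct.ι (fun _ : Fin 2 => A) 1).hom.hom.hom 1 v
  have hu : u = complexBetti.map (biproduct.π (fun _ : Fin 2 => A) 0).hom.hom.hom 1 a₀ +
      complexBetti.map (biproduct.π (fun _ : Fin 2 => A) 1).hom.hom.hom 1 a₁ := by
    rw [← sum_map_π_map_ι (fun _ : Fin 2 => A) u, Fin.sum_univ_two]
  have hv : v = complexBetti.map (biproduct.π (fun _ : Fin 2 => A) 0).hom.hom.hom 1 b₀ +
      complexBetti.map (biproduct.π (fun _ : Fin 2 => A) 1).hom.hom.hom 1 b₁ := by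
    rw [← sum_map_π_map_ι (fun _ : Fin 2 => A) v, Fin.sum_univ_two]
  -- notation for the blocks
  have hc01 : ∀ x y : complexBetti A.X 1, Q₂ (complexBetti.map (biproduct.π (fun _ : Fin 2 => A) 0).hom.hom.hom 1 x)
      (complexBetti.map (biproduct.π (fun _ : Fin 2 => A) 1).hom.hom.hom 1 y) = 0 :=
    fun x y => pairing_two_cross hA (by decide) x y
  have hc10 : ∀ x y : complexBetti A.X 1, Q₂ (complexBetti.map (biproduct.π (fun _ : Fin 2 => A) 1).hom.hom.hom 1 x)
      (complexBetti.map (biproduct.π (fun _ : Fin 2 => A) 0).hom.hom.hom 1 y) = 0 :=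
    fun x y => pairing_two_cross hA (by decide) x y
  have hD1 : ∀ x y : complexBetti A.X 1, Q₂ (complexBetti.map (biproduct.π (fun _ : Fin 2 => A) 1).hom.hom.hom 1 x)
      (complexBetti.map (biproduct.π (fun _ : Fin 2 => A) 1).hom.hom.hom 1 y) =
      (m : ℂ)⁻¹ • Q₂ (complexBetti.map (biproduct.π (fun _ : Fin 2 => A) 0).hom.hom.hom 1 x)
        (complexBetti.map (biproduct.π (fun _ : Fin 2 => A) 0).hom.hom.hom 1 y) := by
    intro x y
    rw [← pairing_two_block_one_eq hA hm hLk x y, smul_smul, inv_mul_cancel₀ hm, one_smul]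
  have hD0 : ∀ x y : complexBetti A.X 1,
      Q₂ (complexBetti.map (biproduct.π (fun _ : Fin 2 => A) 0).hom.hom.hom 1 (complexBetti.map φ.hom.hom.hom 1 x))
        (complexBetti.map (biproduct.π (fun _ : Fin 2 => A) 0).hom.hom.hom 1 y) =
      -Q₂ (complexBetti.map (biproduct.π (fun _ : Fin 2 => A) 0).hom.hom.hom 1 x)
        (complexBetti.map (biproduct.π (fun _ : Fin 2 => A) 0).hom.hom.hom 1 (complexBetti.map φ.hom.hom.hom 1 y)) :=
    fun x y => pairing_two_block_zero_rosati (m := m) hA hLk hros x y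
  -- expand both sides
  rw [hu, hv]
  simp only [map_add, LinearMap.add_apply]
  rw [map_etaTwo_map_π_zero A m φ a₀, map_etaTwo_map_π_one A m φ a₁, map_etaTwo_map_π_zero A m φ b₀,
    map_etaTwo_map_π_one A m φ b₁]
  simp only [map_add, map_smul, LinearMap.add_apply, LinearMap.smul_apply, hc01, hc10, hD1, hD0]
  simp only [smul_smul, mul_inv_cancel₀ hm, one_smul]
  module

end Rosati

end Summit.HodgeConjecture.HodgeConjecture.BiquadraticSecantLift
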